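import Mathlib
import Literature.MathematicalPhysics.QuantumFieldTheory.MagnenRivasseauSeneor1993.MRS93GhostReintegration
import Literature.MathematicalPhysics.QuantumFieldTheory.MagnenRivasseauSeneor1993.MRS93InfinitesimalGauge
import HarnessLib

/-!
# Magnen–Rivasseau–Sénéor, *Construction of YM₄ with an infrared cutoff* (CMP 155, 1993), §II.A p.333 — display
# (II.20), THE FADDEEV–POPOV UNITY «1 = det[K(A)] ∫dγ e^{−(ζ/2)(∂_μA_μ^{γ,∞})²}», K(A) = ∂_μD_μ, AS PRINTED:
# the Gaussian unity PROVED in the finite-dimensional reading, the operator `K(A) = ∂_μD_μ` on pointwise jets with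
# `∂·A^γ = ∂·A + K(A)γ` PROVED (and the quadratic defect of `A^{γ,2}` exhibited), and the free case `A = 0` on a
# ghost window of the torus, where `K(0) = Δ` is invertible exactly because the zero mode is deleted

statement-level skeleton of a published display with citation tags; bookkeeping proved; nothing here is a claim
about the Yang–Mills mass gap, about continuum Yang–Mills on `T⁴` without infrared cutoff, or about the Clay problem —
and nothing of Magnen–Rivasseau–Sénéor's analysis (expansions, bounds, limits) is asserted or formalised

**Citation header (reproduction of PUBLISHED work).** J. Magnen, V. Rivasseau, R. Sénéor, *Construction of YM₄ with
an infrared cutoff*, Commun. Math. Phys. **155** (1993) 325–383 [MagnenRivasseauSeneor1993], §II.A p.333 tl.27–41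
(display (II.20), tl.29, and the sentences around it). Loci `p.NNN tl.nn` = journal page / text-layer line of the held
scan `paper:magnen1993-cmp155-mrs-ym4-infrared-cutoff` (PDF page = journal page − 324); the display was read on the
decoded page IMAGE (render of record `run/shared/lean/pub/lit-balaban/inprint/lit-balaban-p14/renders-cmp155/
p09_full_s6.png`; 2× crop `p09_crop_r2950-3750_s2.png` in the gen-19 seat folder
`run/shared/lean/pub/pub-balaban-gaps/pub-balaban-gaps-mrs-lit-1/g19/`). Cell pub-balaban-gaps, track G3 («MRS 1993
typed AS PRINTED»), seat mrs-lit-1 (gen 19; edition v1.1 gen 20); companion prose `run/shared/lean/pub/pub-balaban-gaps/g3/MRS-AS-PRINTED.md`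
§2, §5. Builds on `…MRS93GhostReintegration` (gen 6: `MainStatement.GhostGaussian.integral_comp_mulVec` — Lebesgue
measure under an invertible linear map of the window coordinates) and `…MRS93InfinitesimalGauge` (gen 5: the pointwise
jets `SectIV.FieldJet` / `GaugeJet`, (II.5) `covD`/`covDDer`, `gaugeLine`/`gaugeInf`, (II.6) `gaugeTrunc2`), and through
them `…MRS93BackgroundGaugeFixing` (`MainStatement.laplaceCoeff`, `(∂²η)~(k) = −|k|²η̃(k)`) and
`…MRS93GaussianReferenceMeasures` (`MainStatement.GhostMode` = the real coordinates of the ghost field `γ`).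

**EDITION v1.1 (gen 20) — DOCSTRINGS ONLY.** Referee gen 60 R8 nit (HOME INBOX l.4293,
[REF-G60-R8-FILE55+FADDEEVPOPOVUNITY+MAINSTATEMENTLIMIT-PASS]): the footnote marker «³» after «A^{γ,∞}» (p.333 tl.41) had been dropped
from the quotation below; it is restored and footnote 3 is quoted with it (re-read on the 2× crops
`g20/renders/p09_crop_r3700-5000_s2.png`, `p09_crop_r5000-5705_s2.png` in the seat folder). Every declaration is
byte-identical to v1 (p397108 ✓ ACCEPTED commit 4dfe7348d573); no import change. The window matrix of `K(A)` for
`A ≠ 0` announced in v1's successor list is the separate leaf `…MRS93FaddeevPopovWindow` (gen 20).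

**Why this file.** After gen 18 every numbered display (II.1)–(II.78) of Sect. II that exists in print ((II.24) is not
printed, `…MRS93PhaseCells`) had a Lean body in one of the 64 modules of this directory EXCEPT (II.20), which three
modules cite as context only (`…BackgroundGaugeFixing`: «the cut-off analogue of inserting «1» via the Faddeev–Popov
formula (II.20)»). This leaf types the display itself.

**What the paper prints (verbatim, from the page image).** p.333 tl.27–41: *«The formal formula for passing from the
axial gauge to the homothetic gauge is obtained by writing*
*1 = det[K(A)] ∫ dγ e^{−(ζ/2)(∂_μ A_μ^{γ,∞})²}, (II.20)*
*where the determinant is the usual determinant of the Fadeev-Popov operator K(A) = ∂_μD_μ, with D_μ as in (II.5)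
(see [IZ]). This formula in itself cannot contain any new information. But we will use an approximation to (II.20)
which amounts no longer to insert 1 but to insert cutoffs, hence there is no contradiction. Remark that we have
written (II.20) in terms of an integration variable γ which lies in the Lie algebra rather than in the Lie group.
Indeed it will be easier for us to give a well defined analogue of this functional integration on a flat Lie algebra
variable, using standard techniques of constructive field theory such as Gaussian measures perturbed by polynomial
interactions. First we will modify (II.20) by using an approximate gauge transformation A^{γ,2} instead of A^{γ,∞} ³.»*
— footnote 3 (p.333 tl.47–49): *«In fact to have correct renormalization group flows to third order in later sections
we have to be more cautious and would need something like A^{γ,10}. But the corresponding formulas are just more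
complicated and the use of A^{γ,2} should make clear how they work in a more general case»*.
With (II.5) p.329 tl.10–11 *«(A^γ)_μ = A_μ + D_μγ, (II.5) where D = ∂ − λ[A,·] is the covariant derivative»*, (II.6)
tl.16–19 *«A^{γ,2}_μ = A_μ + D_μγ + λ/2[γ, ∂_μγ] (II.6) … if g = e^{λγ}, we have A^g = A^{γ,∞}»*, and §II.A p.328
tl.13–15 *«the constant fields or the zero mode in Fourier space is deleted in all our functional integrals, hence
there is no infrared problem»*.

**What is typed here (definitions with bodies; bookkeeping kernel-checked, zero `sorry`, zero named facts).**
* §1 READING (FD) — **the Gaussian unity behind (II.20), PROVED.** `fpIntegral K b ζ` = `∫dγ e^{−(ζ/2)|Kγ + b|²}` over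
  the real window coordinates `γ : ι → ℝ` (Lebesgue measure `dγ` on the FLAT Lie-algebra variable, as the print insists),
  for a real square matrix `K` (the window matrix of `K(A)`) and a vector `b` (the window of `∂·A`);
  `integral_exp_neg_mul_dotProduct_self` (`∫e^{−(ζ/2)z·z}dz = (2π/ζ)^{n/2}`), **`fpIntegral_eq`** (`= |det K|⁻¹(2π/ζ)^{n/2}`
  for `det K ≠ 0`), `fpIntegral_indep` (the value does not depend on `b = ∂·A` — «This formula in itself cannot contain
  any new information»), `fpIntegral_pos`, and **`fp_unity`**: `|det K|·(ζ/2π)^{n/2}·∫dγ e^{−(ζ/2)|Kγ+b|²} = 1` — (II.20)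
  for an affine gauge-variation map `γ ↦ b + Kγ`, with the constant `(ζ/2π)^{n/2}` the print absorbs («formal») restored;
  `integral_mul_fp_unity` (inserting it under any `∫F(A)dμ(A)` changes nothing). AS-PRINTED PRECISION (ad), recorded
  not adjudicated: (II.20) prints `det[K(A)]` WITHOUT absolute-value bars (where (II.77) p.346 prints `det|·|`) and no
  `(ζ/2π)^{n/2}`; with the signed determinant the identity holds iff `det K > 0` (**`fp_unity_signed_iff`**), and at
  `A = 0` (§3) `det Δ_W = (−1)^{|W|}∏|p|²`, so the signed left side is `(−1)^{|W|}` (`fp_signed_freeGhost`).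
* §2 READING (J) — **the Faddeev–Popov operator `K(A) = ∂_μD_μ` on pointwise jets.** `divJ A` = `∂_μA_μ` (trace of the
  1-jet), `laplaceJ γ` = `Δγ = Σ_μ∂_μ∂_μγ`, **`fpOp lam A γ`** = `K(A)γ := Σ_μ ∂_μ(D_μγ)` (gen 5's `covDDer` traced);
  PROVED `fpOp_eq` (`K(A)γ = Δγ − λΣ_μ([∂_μA_μ, γ] + [A_μ, ∂_μγ])`), `fpOp_zero_coupling`/`fpOp_zeroField` (`K = Δ` at
  `λ = 0` or `A = 0`), `fpOp_add`/`fpOp_smul` (linear in `γ`), `divJ_gaugeLine` (`∂·(A + tDγ) = ∂·A + tK(A)γ`),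
  **`divJ_gaugeInf`** (`∂·A^γ = ∂·A + K(A)γ` for (II.5): the exponent of (II.20) is an AFFINE image of `γ` — the case in
  which (II.20) IS the Gaussian unity of §1), and **`divJ_gaugeTrunc2`** (`∂·A^{γ,2} = ∂·A + K(A)γ + (λ/2)[γ, Δγ]` for
  (II.6): already for the truncated transformation the print switches to, a fortiori for `A^{γ,∞} = A^g`, the exponent is
  NOT quadratic in `γ` — (II.20) is then the FORMAL Faddeev–Popov identity, the print's own word «formal formula»).
* §3 **`A = 0` on a finite ghost window of the torus — (II.20) with every symbol concrete.** `momSq p = |p|² = Σ_μp_μ²`,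
  `laplaceSymbol p = −|p|²` (the symbol of `K(0) = Δ` in READING (P), `laplaceCoeff_eq_laplaceSymbol_mul` = the tree's
  `(∂²η)~ = −|k|²η̃`), `momSq_pos`/`laplaceSymbol_neg` (BECAUSE `p ≠ 0`: the deleted zero mode, p.328 tl.13–15, is exactly
  what makes `K(0)` invertible), `laplaceWindow W` = `diag(−|p_w|²)` on `W : Finset GhostMode`, `det_laplaceWindow`
  (`= (−1)^{|W|}∏|p_w|²`), `det_laplaceWindow_ne_zero`, **`fp_unity_freeGhost`** (`(∏_{w∈W}|p_w|²)(ζ/2π)^{|W|/2}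
  ∫dγ e^{−(ζ/2)Σ_w(−|p_w|²γ_w + b_w)²} = 1`) and `fp_signed_freeGhost`.
The print's «approximation to (II.20) which amounts no longer to insert 1 but to insert cutoffs» is (II.37)–(II.39),
typed in `…MRS93BackgroundGaugeFixing` (`Knorm`, `integral_kIntegrand_div_Knorm`) — cross-referenced, not redone.

**Readings (declared).** (FD) FINITE-DIMENSIONAL GAUSSIAN (as in `…MRS93GhostReintegration`): «∫dγ» is Lebesgue measure
on finitely many real coordinates of `γ` and `det` the determinant of the corresponding window matrix; the print's
functional determinant/integral is «formal» by its own word and is not given a meaning here beyond every finite window.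
(J) POINTWISE JETS (as in `…MRS93InfinitesimalGauge`): `K(A) = ∂_μD_μ` is typed through the 1-jet of `A` and the 2-jet
of `γ` at a point; sums over `μ` run over all four indices as printed (`∂_μA_μ`, `∂_μD_μ`). (P) for §3: `∂_μ ↔ ip_μ`
with the tree's integer momenta (`…AxialYMAction`), so `Δ ↔ −|p|²`. (LIN) the identification of (II.20) with §1 is made
for the FIRST-ORDER transformation (II.5) (`divJ_gaugeInf`); for (II.6)/`A^{γ,∞}` only the obstruction
(`divJ_gaugeTrunc2`) is typed.

**What is NOT claimed.** That (II.20) holds as an identity of functional integrals, anything about Gribov copies or the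
global validity of the Faddeev–Popov procedure for `A^{γ,∞}`, any window-independence or `ρ → ∞` statement, anything of
MRS's expansion or of the homothetic-gauge construction the display motivates; cell tally untouched (0/13 theorems,
0/9 spine estimates, 0/6 binders); NOT continuum Yang–Mills on `T⁴` without infrared cutoff, NOT mass gap, NOT Clay,
nothing of Bałaban's.
-/

noncomputable section

open MeasureTheory Finset
open scoped Matrix

namespace Literature.MathematicalPhysics.QuantumFieldTheory.MagnenRivasseauSeneor1993

namespace FaddeevPopovUnity

open MainStatement MainStatement.GhostGaussian SectIV TruncatedGauge InfinitesimalGauge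

/-! ## §1 READING (FD): the Gaussian unity `|det K|·(ζ/2π)^{n/2}·∫dγ e^{−(ζ/2)|Kγ + b|²} = 1` -/

variable {ι : Type*} [Fintype ι]

/-- «∫ dγ e^{−(ζ/2)(∂_μA_μ^{γ})²}» of (II.20) in READING (FD)+(LIN): the Lebesgue integral over the real window
coordinates `γ : ι → ℝ` of the ghost («an integration variable γ which lies in the Lie algebra rather than in the Lie
group … a flat Lie algebra variable», p.333 tl.35–37) of `e^{−(ζ/2)|Kγ + b|²}`, where `K` is the window matrix of the
Faddeev–Popov operator `K(A) = ∂_μD_μ` and `b` the window of `∂_μA_μ`, so that `∂·A^γ = b + Kγ` (§2 `divJ_gaugeInf`).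
[cite: MagnenRivasseauSeneor1993, (II.20) p.333 tl.29] -/
def fpIntegral (K : Matrix ι ι ℝ) (b : ι → ℝ) (ζ : ℝ) : ℝ :=
  ∫ γ : ι → ℝ, Real.exp (-(ζ / 2) * ((K *ᵥ γ + b) ⬝ᵥ (K *ᵥ γ + b)))

/-- The Gaussian integral with the gauge parameter: `∫ e^{−(ζ/2) z·z} dz = (2π/ζ)^{n/2}` over `n` real coordinates
(product of one-dimensional Gaussian integrals; for `ζ ≤ 0` both sides are `0` by Mathlib's conventions).
[cite: MagnenRivasseauSeneor1993, (II.20) p.333 tl.29] -/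
theorem integral_exp_neg_mul_dotProduct_self (ζ : ℝ) :
    ∫ z : ι → ℝ, Real.exp (-(ζ / 2) * (z ⬝ᵥ z)) = Real.sqrt (2 * Real.pi / ζ) ^ Fintype.card ι := by
  have h : ∀ z : ι → ℝ, Real.exp (-(ζ / 2) * (z ⬝ᵥ z)) = ∏ i, Real.exp (-(ζ / 2) * z i ^ 2) := by
    intro z
    rw [← Real.exp_sum, dotProduct, Finset.mul_sum]
    congr 1
    exact Finset.sum_congr rfl fun i _ => by ring
  simp_rw [h]
  rw [integral_fintype_prod_volume_eq_pow (fun t : ℝ => Real.exp (-(ζ / 2) * t ^ 2)), integral_gaussian]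
  congr 2
  rw [div_div_eq_mul_div, mul_comm]

/-- **The value of the Faddeev–Popov Gaussian integral**: for an invertible window matrix `K`,
`∫dγ e^{−(ζ/2)|Kγ + b|²} = |det K|⁻¹ (2π/ζ)^{n/2}` — change of variables `γ ↦ Kγ` (Lebesgue measure scales by
`|det K|⁻¹`, gen 6's `GhostGaussian.integral_comp_mulVec`) and translation invariance in `b`.
[cite: MagnenRivasseauSeneor1993, (II.20) p.333 tl.29–31] -/
theorem fpIntegral_eq [DecidableEq ι] {K : Matrix ι ι ℝ} (hK : K.det ≠ 0) (b : ι → ℝ) (ζ : ℝ) :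
    fpIntegral K b ζ = |K.det|⁻¹ * Real.sqrt (2 * Real.pi / ζ) ^ Fintype.card ι := by
  unfold fpIntegral
  set g : (ι → ℝ) → ℝ := fun y => Real.exp (-(ζ / 2) * ((y + b) ⬝ᵥ (y + b))) with hg
  have hgm : AEStronglyMeasurable g volume := by
    refine Continuous.aestronglyMeasurable ?_
    exact Real.continuous_exp.comp (continuous_const.mul
      ((continuous_id.add continuous_const).dotProduct (continuous_id.add continuous_const)))
  have h1 : (fun γ : ι → ℝ => Real.exp (-(ζ / 2) * ((K *ᵥ γ + b) ⬝ᵥ (K *ᵥ γ + b)))) = fun γ => g (K *ᵥ γ) := rfl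
  rw [h1, integral_comp_mulVec K hK hgm]
  congr 1
  have h2 : ∫ y, g y = ∫ y : ι → ℝ, Real.exp (-(ζ / 2) * (y ⬝ᵥ y)) :=
    integral_add_right_eq_self (fun y : ι → ℝ => Real.exp (-(ζ / 2) * (y ⬝ᵥ y))) b
  rw [h2, integral_exp_neg_mul_dotProduct_self]

/-- «This formula in itself cannot contain any new information» (p.333 tl.32), first face: the value of the
Faddeev–Popov integral does not depend on `b = ∂·A`, i.e. on the configuration `A` through the source term.
[cite: MagnenRivasseauSeneor1993, (II.20) p.333 tl.29–32] -/
theorem fpIntegral_indep [DecidableEq ι] {K : Matrix ι ι ℝ} (hK : K.det ≠ 0) (b : ι → ℝ) (ζ : ℝ) :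
    fpIntegral K b ζ = fpIntegral K 0 ζ := by
  rw [fpIntegral_eq hK, fpIntegral_eq hK]

/-- The Faddeev–Popov integral is positive for `ζ > 0` and invertible `K`. [cite: MagnenRivasseauSeneor1993, (II.20) p.333 tl.29] -/
theorem fpIntegral_pos [DecidableEq ι] {K : Matrix ι ι ℝ} (hK : K.det ≠ 0) (b : ι → ℝ) {ζ : ℝ} (hζ : 0 < ζ) :
    0 < fpIntegral K b ζ := by
  rw [fpIntegral_eq hK]
  exact mul_pos (inv_pos.mpr (abs_pos.mpr hK)) (pow_pos (Real.sqrt_pos.mpr (by positivity)) _)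

/-- **(II.20) IN READING (FD), PROVED — the Faddeev–Popov unity** «1 = det[K(A)] ∫ dγ e^{−(ζ/2)(∂_μA_μ^{γ})²}»: for
every invertible real window matrix `K` (window of `K(A) = ∂_μD_μ`), every `b` (window of `∂·A`) and every `ζ > 0`,
`|det K| · (ζ/2π)^{n/2} · ∫dγ e^{−(ζ/2)|Kγ + b|²} = 1`, with the normalisation `(ζ/2π)^{n/2}` that the «formal formula»
absorbs written out and the determinant in absolute value (precision (ad): `fp_unity_signed_iff`).
[cite: MagnenRivasseauSeneor1993, (II.20) p.333 tl.27–31] -/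
theorem fp_unity [DecidableEq ι] {K : Matrix ι ι ℝ} (hK : K.det ≠ 0) {ζ : ℝ} (hζ : 0 < ζ) (b : ι → ℝ) :
    |K.det| * Real.sqrt (ζ / (2 * Real.pi)) ^ Fintype.card ι * fpIntegral K b ζ = 1 := by
  rw [fpIntegral_eq hK]
  have hπ : Real.pi ≠ 0 := Real.pi_pos.ne'
  have hζ' : ζ ≠ 0 := hζ.ne'
  have hcd : Real.sqrt (ζ / (2 * Real.pi)) * Real.sqrt (2 * Real.pi / ζ) = 1 := by
    rw [← Real.sqrt_mul (by positivity)]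
    have : ζ / (2 * Real.pi) * (2 * Real.pi / ζ) = 1 := by field_simp
    rw [this, Real.sqrt_one]
  have hdet : |K.det| ≠ 0 := abs_ne_zero.mpr hK
  calc |K.det| * Real.sqrt (ζ / (2 * Real.pi)) ^ Fintype.card ι *
        (|K.det|⁻¹ * Real.sqrt (2 * Real.pi / ζ) ^ Fintype.card ι)
      = (|K.det| * |K.det|⁻¹) *
        (Real.sqrt (ζ / (2 * Real.pi)) * Real.sqrt (2 * Real.pi / ζ)) ^ Fintype.card ι := by
          rw [mul_pow]; ring
    _ = 1 := by rw [mul_inv_cancel₀ hdet, hcd, one_pow, one_mul]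

/-- «This formula in itself cannot contain any new information» (p.333 tl.32), second face: inserting the unity
(II.20) under ANY integral `∫F(A)dμ(A)` — with `K(A)`, `∂·A` depending on `A` in any way, as long as every `K(A)` is
invertible — changes nothing. [cite: MagnenRivasseauSeneor1993, (II.20) p.333 tl.29–33] -/
theorem integral_mul_fp_unity [DecidableEq ι] {Ω : Type*} [MeasurableSpace Ω] (μ : Measure Ω) (F : Ω → ℝ)
    (K : Ω → Matrix ι ι ℝ) (b : Ω → ι → ℝ) (hK : ∀ A, (K A).det ≠ 0) {ζ : ℝ} (hζ : 0 < ζ) :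
    ∫ A, F A * (|(K A).det| * Real.sqrt (ζ / (2 * Real.pi)) ^ Fintype.card ι * fpIntegral (K A) (b A) ζ) ∂μ =
      ∫ A, F A ∂μ := by
  have h : ∀ A, |(K A).det| * Real.sqrt (ζ / (2 * Real.pi)) ^ Fintype.card ι * fpIntegral (K A) (b A) ζ = 1 :=
    fun A => fp_unity (hK A) hζ (b A)
  simp_rw [h, mul_one]

/-- AS-PRINTED PRECISION (ad), recorded not adjudicated: (II.20) prints `det[K(A)]` with no absolute-value bars
(while (II.77) p.346 prints `det|Δ − λκ_ρ(p)(…)|`). In READING (FD), with the SIGNED determinant and everything else as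
in `fp_unity`, the identity holds if and only if `det K > 0`. [cite: MagnenRivasseauSeneor1993, (II.20) p.333 tl.29; (II.77) p.346 tl.19] -/
theorem fp_unity_signed_iff [DecidableEq ι] {K : Matrix ι ι ℝ} (hK : K.det ≠ 0) {ζ : ℝ} (hζ : 0 < ζ) (b : ι → ℝ) :
    K.det * Real.sqrt (ζ / (2 * Real.pi)) ^ Fintype.card ι * fpIntegral K b ζ = 1 ↔ 0 < K.det := by
  have hdet : |K.det| ≠ 0 := abs_ne_zero.mpr hK
  have hX : Real.sqrt (ζ / (2 * Real.pi)) ^ Fintype.card ι * fpIntegral K b ζ = |K.det|⁻¹ := by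
    have h := fp_unity hK hζ b
    rw [mul_assoc] at h
    exact eq_inv_of_mul_eq_one_right h
  rw [mul_assoc, hX, mul_inv_eq_one₀ hdet]
  constructor
  · intro h
    exact h ▸ abs_pos.mpr hK
  · intro h
    exact (abs_of_pos h).symm

/-! ## §2 READING (J): the Faddeev–Popov operator `K(A) = ∂_μD_μ` on pointwise jets; `∂·A^γ = ∂·A + K(A)γ` -/

/-- `∂_μA_μ` at the point (trace of the 1-jet; all four indices summed, as printed «∂_μA_μ^{γ,∞}»).
[cite: MagnenRivasseauSeneor1993, (II.20) p.333 tl.29] -/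
def divJ (A : FieldJet) : Fin 3 → ℝ := ∑ μ, A.der μ μ

/-- `Δγ = Σ_μ ∂_μ∂_μγ` at the point. [cite: MagnenRivasseauSeneor1993, (II.20) p.333 tl.30–31] -/
def laplaceJ (γ : GaugeJet) : Fin 3 → ℝ := ∑ μ, γ.der2 μ μ

/-- **The Faddeev–Popov operator «K(A) = ∂_μD_μ, with D_μ as in (II.5)»** applied to `γ`, at the point:
`K(A)γ = Σ_μ ∂_μ(D_μγ)` — the trace of gen 5's `covDDer` (`∂_μ(D_νγ) = ∂_μ∂_νγ − λ[∂_μA_ν, γ] − λ[A_ν, ∂_μγ]`).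
[cite: MagnenRivasseauSeneor1993, (II.20) p.333 tl.30–31; (II.5) p.329 tl.10–11] -/
def fpOp (lam : ℝ) (A : FieldJet) (γ : GaugeJet) : Fin 3 → ℝ := ∑ μ, covDDer lam A γ μ μ

/-- `K(A)γ = Δγ − λΣ_μ([∂_μA_μ, γ] + [A_μ, ∂_μγ])` (Leibniz). [cite: MagnenRivasseauSeneor1993, (II.20) p.333 tl.30–31; (II.5) p.329] -/
theorem fpOp_eq (lam : ℝ) (A : FieldJet) (γ : GaugeJet) :
    fpOp lam A γ = laplaceJ γ - lam • ∑ μ, (bracket (A.der μ μ) γ.val + bracket (A.val μ) (γ.der μ)) := by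
  unfold fpOp laplaceJ covDDer
  rw [Finset.smul_sum, ← Finset.sum_sub_distrib]
  refine Finset.sum_congr rfl fun μ _ => ?_
  rw [smul_add, sub_sub]

/-- At `λ = 0` the Faddeev–Popov operator is the Laplacian: `K(A)γ = Δγ`. [cite: MagnenRivasseauSeneor1993, (II.20) p.333 tl.30–31] -/
theorem fpOp_zero_coupling (A : FieldJet) (γ : GaugeJet) : fpOp 0 A γ = laplaceJ γ := by
  rw [fpOp_eq, zero_smul, sub_zero]

/-- The jet of the zero configuration `A = 0`. [cite: MagnenRivasseauSeneor1993, §II.A p.328 tl.13–15] -/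
def zeroField : FieldJet := ⟨fun _ _ => 0, fun _ _ _ => 0⟩

/-- At the zero configuration the Faddeev–Popov operator is the Laplacian: `K(0)γ = Δγ` (for every `λ`;
`MainStatement.bracket_zero_left` of `…AxialYMAction`).
[cite: MagnenRivasseauSeneor1993, (II.20) p.333 tl.30–31; §II.A p.328 tl.13–15] -/
theorem fpOp_zeroField (lam : ℝ) (γ : GaugeJet) : fpOp lam zeroField γ = laplaceJ γ := by
  rw [fpOp_eq]
  have h : ∀ μ : Fin 4, bracket (zeroField.der μ μ) γ.val + bracket (zeroField.val μ) (γ.der μ) = 0 := by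
    intro μ
    have h1 : zeroField.der μ μ = 0 := rfl
    have h2 : zeroField.val μ = 0 := rfl
    rw [h1, h2, bracket_zero_left, bracket_zero_left, add_zero]
  simp_rw [h]
  rw [Finset.sum_const_zero, smul_zero, sub_zero]

/-- Sum of two ghost jets (values and derivatives add). [cite: MagnenRivasseauSeneor1993, (II.20) p.333 tl.35–37] -/
def gaugeJetAdd (γ γ' : GaugeJet) : GaugeJet :=
  ⟨γ.val + γ'.val, fun μ => γ.der μ + γ'.der μ, fun μ ν => γ.der2 μ ν + γ'.der2 μ ν⟩

/-- Scalar multiple of a ghost jet. [cite: MagnenRivasseauSeneor1993, (II.20) p.333 tl.35–37] -/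
def gaugeJetSmul (t : ℝ) (γ : GaugeJet) : GaugeJet :=
  ⟨t • γ.val, fun μ => t • γ.der μ, fun μ ν => t • γ.der2 μ ν⟩

/-- The bracket is additive in its second entry. [cite: MagnenRivasseauSeneor1993, §II.A p.328 tl.32–33] -/
theorem bracket_add_right (X Y Z : Fin 3 → ℝ) : bracket X (Y + Z) = bracket X Y + bracket X Z := by
  ext a
  simp only [bracket, Pi.add_apply, mul_add, Finset.sum_add_distrib]

/-- The bracket is homogeneous in its second entry. [cite: MagnenRivasseauSeneor1993, §II.A p.328 tl.32–33] -/
theorem bracket_smul_right (t : ℝ) (X Y : Fin 3 → ℝ) : bracket X (t • Y) = t • bracket X Y := by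
  ext a
  simp only [bracket, Pi.smul_apply, smul_eq_mul, Finset.mul_sum]
  exact Finset.sum_congr rfl fun b _ => Finset.sum_congr rfl fun c _ => by ring

/-- `K(A)` is additive in `γ` — it is a LINEAR operator on the (flat) ghost variable.
[cite: MagnenRivasseauSeneor1993, (II.20) p.333 tl.30–37] -/
theorem fpOp_add (lam : ℝ) (A : FieldJet) (γ γ' : GaugeJet) :
    fpOp lam A (gaugeJetAdd γ γ') = fpOp lam A γ + fpOp lam A γ' := by
  unfold fpOp covDDer gaugeJetAdd
  rw [← Finset.sum_add_distrib]
  refine Finset.sum_congr rfl fun μ _ => ?_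
  simp only [bracket_add_right, smul_add]
  abel

/-- `K(A)` is homogeneous in `γ`. [cite: MagnenRivasseauSeneor1993, (II.20) p.333 tl.30–37] -/
theorem fpOp_smul (lam : ℝ) (A : FieldJet) (t : ℝ) (γ : GaugeJet) :
    fpOp lam A (gaugeJetSmul t γ) = t • fpOp lam A γ := by
  unfold fpOp covDDer gaugeJetSmul
  rw [Finset.smul_sum]
  refine Finset.sum_congr rfl fun μ _ => ?_
  simp only [bracket_smul_right, smul_sub, smul_comm t lam]

/-- `∂·(A + B) = ∂·A + ∂·B` on jets. [cite: MagnenRivasseauSeneor1993, (II.20) p.333 tl.29] -/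
theorem divJ_add (A B : FieldJet) : divJ (A.add B) = divJ A + divJ B := by
  unfold divJ FieldJet.add
  exact Finset.sum_add_distrib

/-- Along the line of (II.5), `∂·(A + tDγ) = ∂·A + t·K(A)γ`. [cite: MagnenRivasseauSeneor1993, (II.20) p.333; (II.5) p.329] -/
theorem divJ_gaugeLine (lam : ℝ) (A : FieldJet) (γ : GaugeJet) (t : ℝ) :
    divJ (gaugeLine lam A γ t) = divJ A + t • fpOp lam A γ := by
  unfold divJ fpOp
  simp_rw [gaugeLine_der]
  rw [Finset.sum_add_distrib, Finset.smul_sum]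

/-- **`∂·A^γ = ∂·A + K(A)γ` for the first-order gauge transformation (II.5)** — the divergence of `A^γ = A + Dγ` is an
AFFINE function of the ghost jet with linear part the Faddeev–Popov operator `K(A) = ∂_μD_μ`: exactly the structure
under which (II.20) is the Gaussian unity of §1 (`fp_unity` with `b` = window of `∂·A`, `K` = window matrix of `K(A)`).
[cite: MagnenRivasseauSeneor1993, (II.20) p.333 tl.29–31; (II.5) p.329 tl.10–11] -/
theorem divJ_gaugeInf (lam : ℝ) (A : FieldJet) (γ : GaugeJet) :
    divJ (gaugeInf lam A γ) = divJ A + fpOp lam A γ := by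
  rw [gaugeInf, divJ_gaugeLine, one_smul]

/-- The printed wedge product of a vector with itself vanishes. [cite: MagnenRivasseauSeneor1993, §II.A p.328 tl.32–33] -/
theorem bracket_self (X : Fin 3 → ℝ) : bracket X X = 0 := by
  have h := bracket_swap X X
  ext a
  have ha := congrFun h a
  simp only [Pi.neg_apply] at ha
  simp only [Pi.zero_apply]
  linarith

/-- The bracket commutes with finite sums in its second entry. [cite: MagnenRivasseauSeneor1993, §II.A p.328 tl.32–33] -/
theorem bracket_sum_right {α : Type*} (s : Finset α) (X : Fin 3 → ℝ) (Y : α → Fin 3 → ℝ) :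
    bracket X (∑ i ∈ s, Y i) = ∑ i ∈ s, bracket X (Y i) := by
  classical
  induction s using Finset.induction_on with
  | empty =>
    rw [Finset.sum_empty, Finset.sum_empty]
    ext a
    simp [bracket]
  | insert i s hi ih => rw [Finset.sum_insert hi, Finset.sum_insert hi, bracket_add_right, ih]

/-- **`∂·A^{γ,2} = ∂·A + K(A)γ + (λ/2)[γ, Δγ]` for the truncated transformation (II.6)** — the divergence of
`A^{γ,2} = A + Dγ + (λ/2)[γ, ∂γ]` picks up the QUADRATIC term `(λ/2)Σ_μ([∂_μγ, ∂_μγ] + [γ, ∂_μ∂_μγ]) = (λ/2)[γ, Δγ]`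
(`[∂_μγ, ∂_μγ] = 0`). Hence for `A^{γ,2}` — the transformation the print substitutes into (II.20) («First we will modify
(II.20) by using an approximate gauge transformation A^{γ,2} instead of A^{γ,∞}») — and a fortiori for `A^{γ,∞} = A^g`,
the exponent `−(ζ/2)(∂_μA_μ^{γ,·})²` is NOT a quadratic form in `γ`: there (II.20) is the FORMAL Faddeev–Popov identity
(«The formal formula»), not the Gaussian unity of §1. [cite: MagnenRivasseauSeneor1993, (II.20) p.333 tl.27–41; (II.6) p.329 tl.16–19] -/
theorem divJ_gaugeTrunc2 (lam : ℝ) (A : FieldJet) (γ : GaugeJet) :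
    divJ (gaugeTrunc2 lam A γ) = divJ A + fpOp lam A γ + (lam / 2) • bracket γ.val (laplaceJ γ) := by
  unfold divJ fpOp laplaceJ gaugeTrunc2
  simp only
  rw [bracket_sum_right, Finset.smul_sum, ← Finset.sum_add_distrib, ← Finset.sum_add_distrib]
  refine Finset.sum_congr rfl fun μ _ => ?_
  rw [bracket_self, zero_add]

/-- The defect is genuinely there: at `A = 0`, `λ = 2`, for the jet `γ` with value `e₀`, no first derivatives and
`∂_0∂_0γ = e₁`, `∂·A^{γ,2} − (∂·A + K(A)γ) = [e₀, e₁] = e₂ ≠ 0`. [cite: MagnenRivasseauSeneor1993, (II.20) p.333; (II.6) p.329] -/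
theorem divJ_gaugeTrunc2_defect_witness :
    let γ : GaugeJet := ⟨Pi.single 0 1, fun _ => 0, fun μ ν => if μ = 0 ∧ ν = 0 then Pi.single 1 1 else 0⟩
    divJ (gaugeTrunc2 2 zeroField γ) - (divJ zeroField + fpOp 2 zeroField γ) = Pi.single 2 1 := by
  intro γ
  rw [divJ_gaugeTrunc2, add_sub_cancel_left]
  have hΔ : laplaceJ γ = Pi.single 1 1 := by
    unfold laplaceJ
    simp [γ]
  rw [hΔ]
  ext a
  fin_cases a <;> simp [γ, bracket, eps, Fin.sum_univ_three]

/-! ## §3 READING (P): `K(A) = ∂_μD_μ` on cut-off fields in momentum space; `U(A′_s, 0) = K(A′_s)` — the operator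
of (II.68) at zero background field IS the Faddeev–Popov operator of (II.20) -/

/-- `(∂·X)~(k) = Σ_μ ik_μ X̃_μ(k)` — the divergence of a vector-type coefficient function (READING (P): `∂_μ ↔ ik_μ`).
[cite: MagnenRivasseauSeneor1993, (II.20) p.333 tl.29; §II.A p.328 tl.12–15] -/
def divCoeff (X : (Fin 4 → ℤ) → Fin 4 → Fin 3 → ℂ) (k : Fin 4 → ℤ) : Fin 3 → ℂ :=
  ∑ μ, dCoeff (fun k' => X k' μ) μ k

/-- **«K(A) = ∂_μD_μ, with D_μ as in (II.5)»** on a ghost-type coefficient function `η`, in momentum space, LITERALLY: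
`(K(A)η)~(k) = Σ_μ (∂_μ(D_μη))~(k)` with gen 5's `covDCoeff` (`(D_μη)~(k) = ik_μη̃(k) − λΣ_{q+r=k}Ã_μ(q) ×₃ η̃(r)`) for a
cut-off field `A` given by a coefficient function supported in `T`. [cite: MagnenRivasseauSeneor1993, (II.20) p.333 tl.30–31; (II.5) p.329 tl.10–11] -/
def fpOpCoeff (T : Finset (Fin 4 → ℤ)) (lam : ℝ) (A : (Fin 4 → ℤ) → Fin 4 → Fin 3 → ℂ)
    (η : (Fin 4 → ℤ) → Fin 3 → ℂ) (k : Fin 4 → ℤ) : Fin 3 → ℂ :=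
  ∑ μ, dCoeff (fun k' => covDCoeff T lam A η μ k') μ k

/-- `∂_μ` of a difference with a scalar multiple (linearity of `ik_μ·`). [cite: MagnenRivasseauSeneor1993, §II.A p.328 tl.12–15] -/
theorem dCoeff_sub_smul (X Y : (Fin 4 → ℤ) → Fin 3 → ℂ) (c : ℂ) (μ : Fin 4) (k : Fin 4 → ℤ) :
    dCoeff (fun k' => X k' - c • Y k') μ k = dCoeff X μ k - c • dCoeff Y μ k := by
  ext a
  simp [dCoeff]
  ring

/-- **`K(A)η = ∂²η − λ∂_μ[A_μ, η]`** in momentum space: `(K(A)η)~(k) = −|k|²η̃(k) − λΣ_μ ik_μ Σ_{q+r=k} Ã_μ(q) ×₃ η̃(r)`.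
[cite: MagnenRivasseauSeneor1993, (II.20) p.333 tl.30–31; (II.5) p.329; (II.68) p.344 tl.19] -/
theorem fpOpCoeff_eq (T : Finset (Fin 4 → ℤ)) (lam : ℝ) (A : (Fin 4 → ℤ) → Fin 4 → Fin 3 → ℂ)
    (η : (Fin 4 → ℤ) → Fin 3 → ℂ) (k : Fin 4 → ℤ) :
    fpOpCoeff T lam A η k = laplaceCoeff η k -
      (lam : ℂ) • ∑ μ, dCoeff (fun k' => convCross (insert 0 T) (fun q => A q μ) η k') μ k := by
  unfold fpOpCoeff laplaceCoeff covDCoeff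
  rw [Finset.smul_sum, ← Finset.sum_sub_distrib]
  refine Finset.sum_congr rfl fun μ _ => ?_
  exact dCoeff_sub_smul (dCoeff η μ) _ (lam : ℂ) μ k

/-- **`U(A′_s, 0) = K(A′_s)`: (II.68)'s operator `U(A′_s, B′_l) ≡ ∂² − λ∂[A′_s, ·] − λΣ_j[κ_j ∗ B′_l, κ^j ∗ ∂·]` (gen 5's
`MainStatement.uOp`) at ZERO background field `B′_l = 0` IS the Faddeev–Popov operator `K(A′_s) = ∂_μD_μ` of (II.20)** —
the background-covariant homothetic gauge of §II.D reduces to the ordinary one of (II.20) when there is no large field.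
[cite: MagnenRivasseauSeneor1993, (II.20) p.333 tl.30–31; (II.68) p.344 tl.19; p.334 tl.11–14] -/
theorem uOp_zero_background (par : Parameters) (Nlow : ℕ → ℕ) (T : Finset (Fin 4 → ℤ)) (ρ₁ : ℕ) (lam : ℝ)
    (A : (Fin 4 → ℤ) → Fin 4 → Fin 3 → ℂ) (η : (Fin 4 → ℤ) → Fin 3 → ℂ) (k : Fin 4 → ℤ) :
    uOp par Nlow T ρ₁ lam A 0 η k = fpOpCoeff T lam A η k := by
  rw [uOp_eq, fpOpCoeff_eq]
  have h2 : ∀ (j : ℕ × ℕ) (μ : Fin 4), uOpB par Nlow T ρ₁ 0 η j μ k = 0 := by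
    intro j μ
    unfold uOpB
    have : (fun q => ((par.kappaLow Nlow ρ₁ j q : ℝ) : ℂ) • fun a => (0 : (Fin 4 → ℤ) → Fin 4 → Fin 3 → ℂ) q μ a)
        = fun _ => 0 := funext fun q => by ext a; simp
    rw [this]
    exact convCross_zero_left (box2 T) _ k
  simp only [h2, Finset.sum_const_zero, smul_zero, sub_zero]

/-- At `A = 0` (or `λ = 0`) the Faddeev–Popov operator is the free ghost Laplacian `∂²`.
[cite: MagnenRivasseauSeneor1993, (II.20) p.333 tl.30–31; §II.A p.328 tl.13–15] -/
theorem fpOpCoeff_zero_field (T : Finset (Fin 4 → ℤ)) (lam : ℝ) (η : (Fin 4 → ℤ) → Fin 3 → ℂ) (k : Fin 4 → ℤ) :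
    fpOpCoeff T lam 0 η k = laplaceCoeff η k := by
  rw [fpOpCoeff_eq]
  have h1 : ∀ μ : Fin 4, (fun k' => convCross (insert 0 T) (fun q => (0 : (Fin 4 → ℤ) → Fin 4 → Fin 3 → ℂ) q μ) η k')
      = fun _ => 0 := fun μ => funext fun k' => convCross_zero_left (insert 0 T) η k'
  have h3 : ∀ μ : Fin 4, dCoeff (fun _ => (0 : Fin 3 → ℂ)) μ k = 0 := fun μ => by ext a; simp [dCoeff]
  simp only [h1, h3, Finset.sum_const_zero, smul_zero, sub_zero]

/-- `K(A)` is ADDITIVE in the ghost field … [cite: MagnenRivasseauSeneor1993, (II.20) p.333 tl.30–37] -/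
theorem fpOpCoeff_add (T : Finset (Fin 4 → ℤ)) (lam : ℝ) (A : (Fin 4 → ℤ) → Fin 4 → Fin 3 → ℂ)
    (η₁ η₂ : (Fin 4 → ℤ) → Fin 3 → ℂ) (k : Fin 4 → ℤ) :
    fpOpCoeff T lam A (η₁ + η₂) k = fpOpCoeff T lam A η₁ k + fpOpCoeff T lam A η₂ k := by
  simp only [fpOpCoeff_eq, laplaceCoeff_add, uOpA_add, Finset.sum_add_distrib, smul_add]
  abel

/-- … and HOMOGENEOUS: a linear operator on the flat ghost variable, as «det[K(A)]» presupposes.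
[cite: MagnenRivasseauSeneor1993, (II.20) p.333 tl.30–37] -/
theorem fpOpCoeff_smul (T : Finset (Fin 4 → ℤ)) (lam : ℝ) (A : (Fin 4 → ℤ) → Fin 4 → Fin 3 → ℂ) (c : ℂ)
    (η : (Fin 4 → ℤ) → Fin 3 → ℂ) (k : Fin 4 → ℤ) :
    fpOpCoeff T lam A (c • η) k = c • fpOpCoeff T lam A η k := by
  simp only [fpOpCoeff_eq, laplaceCoeff_smul, uOpA_smul, ← Finset.smul_sum, smul_sub, smul_comm c (lam : ℂ)]

/-- **(II.5) in momentum space and its divergence: `(∂·A^γ)~ = (∂·A)~ + (K(A)γ)~`** — with `(A^γ)_μ = A_μ + D_μγ`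
(`covDCoeff`), the momentum-space twin of `divJ_gaugeInf`. [cite: MagnenRivasseauSeneor1993, (II.20) p.333 tl.29–31; (II.5) p.329 tl.10–11] -/
theorem divCoeff_gaugeInf (T : Finset (Fin 4 → ℤ)) (lam : ℝ) (A : (Fin 4 → ℤ) → Fin 4 → Fin 3 → ℂ)
    (G : (Fin 4 → ℤ) → Fin 3 → ℂ) (k : Fin 4 → ℤ) :
    divCoeff (fun k' μ => A k' μ + covDCoeff T lam A G μ k') k = divCoeff A k + fpOpCoeff T lam A G k := by
  unfold divCoeff fpOpCoeff
  rw [← Finset.sum_add_distrib]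
  refine Finset.sum_congr rfl fun μ _ => ?_
  exact dCoeff_add (fun k' => A k' μ) (fun k' => covDCoeff T lam A G μ k') μ k

/-- **(II.6) in momentum space and its divergence: `(∂·A^{γ,2})~ = (∂·A)~ + (K(A)γ)~ + (λ/2)Σ_μ(∂_μ[γ, ∂_μγ])~`** — gen 5's
`gaugeTrunc2Coeff` IS `A + Dγ + (λ/2)[γ, ∂γ]` (`covDCoeff` inside), and the last, QUADRATIC-in-`γ` term is what separates
(II.20) for `A^{γ,2}` (a fortiori `A^{γ,∞}`) from the Gaussian unity of §1 (momentum-space twin of `divJ_gaugeTrunc2`).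
[cite: MagnenRivasseauSeneor1993, (II.20) p.333 tl.27–41; (II.6) p.329 tl.16–19] -/
theorem divCoeff_gaugeTrunc2 (T : Finset (Fin 4 → ℤ)) (lam : ℝ) (A : (Fin 4 → ℤ) → Fin 4 → Fin 3 → ℂ)
    (G : (Fin 4 → ℤ) → Fin 3 → ℂ) (k : Fin 4 → ℤ) :
    divCoeff (fun k' μ => gaugeTrunc2Coeff T lam A G μ k') k = divCoeff A k + fpOpCoeff T lam A G k +
      ((lam / 2 : ℝ) : ℂ) • ∑ μ, dCoeff (fun k' => convCross (insert 0 T) G (dCoeff G μ) k') μ k := by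
  unfold divCoeff fpOpCoeff
  rw [Finset.smul_sum, ← Finset.sum_add_distrib, ← Finset.sum_add_distrib]
  refine Finset.sum_congr rfl fun μ _ => ?_
  ext a
  simp [gaugeTrunc2Coeff, covDCoeff, dCoeff]
  ring

/-! ## §4 `A = 0` on a finite ghost window of the torus: `K(0) = Δ = diag(−|p|²)`, invertible because the zero mode
is deleted; (II.20) with every symbol concrete; invertibility of `Δ − λX` for small coupling -/

/-- `|p|² = Σ_μ p_μ²` of a (nonzero) lattice momentum. [cite: MagnenRivasseauSeneor1993, §II.A p.328 tl.12–15] -/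
def momSq (p : Momentum) : ℝ := ∑ μ, ((p.1 μ : ℤ) : ℝ) ^ 2

/-- The symbol of `K(0) = Δ = ∂_μ∂_μ` in READING (P) (`∂_μ ↔ ip_μ`): `−|p|²`. [cite: MagnenRivasseauSeneor1993, (II.20) p.333 tl.30–31; §II.A p.328 tl.12–15] -/
def laplaceSymbol (p : Momentum) : ℝ := -momSq p

/-- **`|p|² > 0` BECAUSE the zero mode is deleted** («the constant fields or the zero mode in Fourier space is deleted
in all our functional integrals, hence there is no infrared problem», p.328 tl.13–15; `Momentum = {p ≠ 0}`).
[cite: MagnenRivasseauSeneor1993, §II.A p.328 tl.13–15] -/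
theorem momSq_pos (p : Momentum) : 0 < momSq p := by
  have hne : ∃ μ, p.1 μ ≠ 0 := by
    by_contra h
    exact p.2 (funext fun μ => not_not.mp (not_exists.mp h μ))
  obtain ⟨μ, hμ⟩ := hne
  have hμ' : (0 : ℝ) < ((p.1 μ : ℤ) : ℝ) ^ 2 := by
    have : ((p.1 μ : ℤ) : ℝ) ≠ 0 := by exact_mod_cast hμ
    positivity
  exact lt_of_lt_of_le hμ' (Finset.single_le_sum (f := fun ν => ((p.1 ν : ℤ) : ℝ) ^ 2)
    (fun ν _ => sq_nonneg _) (Finset.mem_univ μ))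

/-- The Laplacian symbol is negative (in particular nonzero) on every mode of the zero-mode-deleted lattice.
[cite: MagnenRivasseauSeneor1993, (II.20) p.333; §II.A p.328 tl.13–15] -/
theorem laplaceSymbol_neg (p : Momentum) : laplaceSymbol p < 0 := by
  unfold laplaceSymbol
  exact neg_neg_of_pos (momSq_pos p)

/-- The tree's momentum-space Laplacian on ghost coefficient functions (`MainStatement.laplaceCoeff`, READING (P)) IS
multiplication by `laplaceSymbol`: `(∂²η)~(p) = −|p|² η̃(p)`. [cite: MagnenRivasseauSeneor1993, (II.20) p.333 tl.30–31; (II.68) p.344] -/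
theorem laplaceCoeff_eq_laplaceSymbol_mul (η : (Fin 4 → ℤ) → Fin 3 → ℂ) (p : Momentum) (a : Fin 3) :
    laplaceCoeff η p.1 a = (laplaceSymbol p : ℂ) * η p.1 a := by
  rw [laplaceCoeff_apply, laplaceSymbol, momSq]
  push_cast
  rfl

/-- The window matrix of `K(0) = Δ` on a finite set `W` of real ghost coordinates (`GhostMode = Momentum × Fin 3 ×
Bool`: momentum, colour, real/imaginary part): diagonal with entries `−|p_w|²`.
[cite: MagnenRivasseauSeneor1993, (II.20) p.333 tl.29–31] -/
def laplaceWindow (W : Finset GhostMode) : Matrix W W ℝ := Matrix.diagonal fun w => laplaceSymbol w.1.1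

/-- `K(0)` acts on the window diagonally: `(Δ_W γ)_w = −|p_w|² γ_w`. [cite: MagnenRivasseauSeneor1993, (II.20) p.333 tl.29–31] -/
theorem laplaceWindow_mulVec (W : Finset GhostMode) (γ : W → ℝ) (w : W) :
    (laplaceWindow W *ᵥ γ) w = laplaceSymbol w.1.1 * γ w := by
  rw [laplaceWindow, Matrix.mulVec_diagonal]

/-- `det Δ_W = (−1)^{|W|} ∏_{w∈W} |p_w|²`. [cite: MagnenRivasseauSeneor1993, (II.20) p.333 tl.29–31] -/
theorem det_laplaceWindow (W : Finset GhostMode) :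
    (laplaceWindow W).det = (-1) ^ Fintype.card W * ∏ w : W, momSq w.1.1 := by
  rw [laplaceWindow, Matrix.det_diagonal]
  simp only [laplaceSymbol]
  rw [← Finset.card_univ, ← Finset.prod_const, ← Finset.prod_mul_distrib]
  exact Finset.prod_congr rfl fun w _ => by ring

/-- `Δ_W` is invertible — a consequence of the deleted zero mode. [cite: MagnenRivasseauSeneor1993, (II.20) p.333; §II.A p.328 tl.13–15] -/
theorem det_laplaceWindow_ne_zero (W : Finset GhostMode) : (laplaceWindow W).det ≠ 0 := by
  rw [laplaceWindow, Matrix.det_diagonal]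
  exact Finset.prod_ne_zero_iff.mpr fun w _ => (laplaceSymbol_neg w.1.1).ne

/-- `|det Δ_W| = ∏_{w∈W} |p_w|²`. [cite: MagnenRivasseauSeneor1993, (II.20) p.333 tl.29–31] -/
theorem abs_det_laplaceWindow (W : Finset GhostMode) :
    |(laplaceWindow W).det| = ∏ w : W, momSq w.1.1 := by
  rw [det_laplaceWindow, abs_mul, abs_pow, abs_neg, abs_one, one_pow, one_mul]
  exact abs_of_nonneg (Finset.prod_nonneg fun w _ => (momSq_pos w.1.1).le)

/-- **(II.20) AT `A = 0` ON ANY FINITE GHOST WINDOW OF THE TORUS, every symbol concrete**: with `K(0) = Δ`,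
`(∏_{w∈W} |p_w|²) · (ζ/2π)^{|W|/2} · ∫dγ e^{−(ζ/2) Σ_w (−|p_w|²γ_w + b_w)²} = 1` for every `ζ > 0` and every source
window `b` (= window of `∂·A`, here arbitrary). [cite: MagnenRivasseauSeneor1993, (II.20) p.333 tl.27–31; §II.A p.328 tl.13–15] -/
theorem fp_unity_freeGhost (W : Finset GhostMode) {ζ : ℝ} (hζ : 0 < ζ) (b : W → ℝ) :
    (∏ w : W, momSq w.1.1) * Real.sqrt (ζ / (2 * Real.pi)) ^ Fintype.card W *
        fpIntegral (laplaceWindow W) b ζ = 1 := by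
  rw [← abs_det_laplaceWindow]
  exact fp_unity (det_laplaceWindow_ne_zero W) hζ b

/-- Precision (ad) exhibited at `A = 0`: with the SIGNED determinant printed in (II.20), the left side on the window `W`
equals `(−1)^{|W|}` — it is `1` iff `|W|` is even. [cite: MagnenRivasseauSeneor1993, (II.20) p.333 tl.29; (II.77) p.346 tl.19] -/
theorem fp_signed_freeGhost (W : Finset GhostMode) {ζ : ℝ} (hζ : 0 < ζ) (b : W → ℝ) :
    (laplaceWindow W).det * Real.sqrt (ζ / (2 * Real.pi)) ^ Fintype.card W * fpIntegral (laplaceWindow W) b ζ =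
      (-1) ^ Fintype.card W := by
  rw [det_laplaceWindow, mul_assoc, mul_assoc, ← mul_assoc (∏ w : W, momSq w.1.1), fp_unity_freeGhost W hζ b, mul_one]

/-- **`K(A) = Δ − λ·∂_μ[A_μ, ·]` on a window is invertible for small coupling**: whatever the window matrix `X` of the
first-order part `∂_μ[A_μ, ·]` of the Faddeev–Popov operator (`fpOpCoeff_eq`) is, `det(Δ_W − λX) ≠ 0` for all `λ` in
a neighbourhood of `0` — continuity of the determinant from the free value `det Δ_W ≠ 0` (deleted zero mode). The print's
regime is `λ → 0` (p.329 tl.14–15 «we want to keep all terms not small as λ → 0»). [cite: MagnenRivasseauSeneor1993, (II.20) p.333 tl.29–31; §II.A p.328 tl.13–15, p.329 tl.14–15] -/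
theorem det_laplaceWindow_sub_smul_eventually_ne_zero (W : Finset GhostMode) (X : Matrix W W ℝ) :
    ∀ᶠ lam in nhds (0 : ℝ), (laplaceWindow W - lam • X).det ≠ 0 := by
  have hc : Continuous fun lam : ℝ => (laplaceWindow W - lam • X).det :=
    (continuous_const.sub (continuous_id.smul continuous_const)).matrix_det
  have h0 : (fun lam : ℝ => (laplaceWindow W - lam • X).det) 0 ≠ 0 := by
    simp only [zero_smul, sub_zero]
    exact det_laplaceWindow_ne_zero W
  exact hc.continuousAt.eventually_ne h0

/-- **(II.20) in READING (FD) for the interacting Faddeev–Popov window matrix `Δ_W − λX`, for all small couplings**: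
`|det(Δ_W − λX)|·(ζ/2π)^{|W|/2}·∫dγ e^{−(ζ/2)|(Δ_W − λX)γ + b|²} = 1` for every `λ` near `0`, every `X`, `b`, `ζ > 0`.
[cite: MagnenRivasseauSeneor1993, (II.20) p.333 tl.27–31; p.329 tl.14–15] -/
theorem fp_unity_smallCoupling (W : Finset GhostMode) (X : Matrix W W ℝ) {ζ : ℝ} (hζ : 0 < ζ) (b : W → ℝ) :
    ∀ᶠ lam in nhds (0 : ℝ), |(laplaceWindow W - lam • X).det| * Real.sqrt (ζ / (2 * Real.pi)) ^ Fintype.card W *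
      fpIntegral (laplaceWindow W - lam • X) b ζ = 1 :=
  (det_laplaceWindow_sub_smul_eventually_ne_zero W X).mono fun _ h => fp_unity h hζ b

end FaddeevPopovUnity

end Literature.MathematicalPhysics.QuantumFieldTheory.MagnenRivasseauSeneor1993
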